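import Summits.ValiantsHypothesis.ValiantsHypothesis.Theorems.SymPencilPerFourOneRowToricHyp
import Summits.ValiantsHypothesis.ValiantsHypothesis.Theorems.SymPencilPerFourOneRowReading

/-!
# Route `SymPencil` — leaf R1N of the `(11, 5, 4)` cascade, §6.6 TORIC branch, product case `(2, 2, 1)` — tools
# (`--supports` stmt-ValiantsHypothesis-5674 `SdcSuperquadratic`; memo `SING-FIVE-CLASSIFICATION.md` §6.6 (T-prod), for the
# residual `stub_R1N_residual` (`R1NToric K`) of `Cruxes/SdcSuperquadratic/Lines/sing_five_classification.lean`; rung currency only)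

Setting (normalised): `W ⊆ K^{4×4}` singular, `dim W = 5`, zero row `0`, live rows `1, 2, 3` with row spaces
`A = A₁`, `B = A₂` of dimension `2` and `A₃ = K c₀` of dimension `1`; then `W = A × B × K c₀` is a product and
`T3 (a, b, c₀) = 0` on `A × B`.  Instead of the memo's analysis by `|supp c₀|` (and its `W₀` witness), the proof reads
the per-direction family at the THREE-row elements `(a; b; c₀)` (✓ `minors_three_rows`: the three pairing matrices
`P(b,c₀), P(a,c₀), P(a,b)` have a common column space of dimension `≤ 2`):

* `finrank_le_one_of_permOrth` — no `2`-plane is perm-orthogonal to a non-zero vector; hence some `b₁ ∈ B` has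
  `P(b₁,c₀) ≠ 0`, i.e. of rank `2` with kernel exactly `A`;
* `caseI` — then the columns of `P(a,c₀)` and `P(a,b₁)` lie in `A^⊥` too: `T3 (A, A, c₀) = 0` and `T3 (A, A, b₁) = 0`
  (`dep_of_minors`: three columns of a `4 × 3` matrix with vanishing maximal minors are dependent);
* (in the continuation `SymPencilPerFourOneRowToricProd`) `toric_prod_absurd` — symmetrically `T3 (B, B, c₀) = 0`; if `B ⊄ A` then `T3 (U, B, c₀) = 0` on the `3`-space
  `U = A + K b` forces `B ⊥ c₀` (✓ `permOrth_of_T3_hyperplane`), contradicting the first bullet; if `B = A` then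
  `T3 ≡ 0` on `A × A × A`, the toric triple lemma gives two common zero coordinates `p, q` of `A`, the no-zero-column
  hypothesis gives `c₀(p), c₀(q) ≠ 0`, and `T3 (a, a, c₀)_p = 2 c₀(q) a_{p'} a_{q'}` leaves `dim A ≤ 1`.

Honest framing: [folklore] linear algebra for ONE sub-case of ONE leaf of ONE of four open size-27 cells; leaf R1N and the cell
file remain OPEN until the wiring lands; `27 ≤ sdc(per₄) ≤ 29` unchanged; the crux `SdcSuperquadratic` and `VP ≠ VNP` untouched;
no summit statement is proved here.  No definitions, no named facts.
-/

noncomputable section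

set_option linter.dupNamespace false

namespace Summit.ValiantsHypothesis.ValiantsHypothesis.Theorems.SymPencilPerFourOneRowToric

open Module MvPolynomial
open Literature.Computability.AlgebraicComplexity
open Summit.ValiantsHypothesis.ValiantsHypothesis.Theorems.SymPencilSingSixClassification
open Summit.ValiantsHypothesis.ValiantsHypothesis.Theorems.SymPencilPerFourOneRowKernelPlane
open Summit.ValiantsHypothesis.ValiantsHypothesis.Theorems.SymPencilPerFourOneRowReading

variable {K : Type*} [Field K]

/-! ## 1. Small tools -/

/-- The `4`-linear form `Σ_l T3(u,v,w)_l z_l` (the permanent of `(u; v; w; z)`) is symmetric in `u ↔ z`. [folklore] -/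
theorem T3_dot_swap (u v w z : Fin 4 → K) : ∑ l, T3 u v w l * z l = ∑ l, T3 z v w l * u l := by
  simp only [Fin.sum_univ_four, (T3_explicit _ _ _).1, (T3_explicit _ _ _).2.1, (T3_explicit _ _ _).2.2.1,
    (T3_explicit _ _ _).2.2.2]
  ring

/-- Pairing against a coordinate vector picks a coordinate. [folklore] -/
theorem sum_T3_single (u v w : Fin 4 → K) (m : Fin 4) :
    ∑ l, T3 u v w l * (Pi.single m 1 : Fin 4 → K) l = T3 u v w m := by
  simp [Pi.single_apply, Finset.sum_ite_eq']

/-- If the polar matrix `(T3 e_l v w)_m` vanishes identically then `v ⊥ w`. [folklore] -/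
theorem exists_T3_single_ne_zero {v w : Fin 4 → K} (h : ¬ PermOrth v w) :
    ∃ l m : Fin 4, T3 (Pi.single l 1) v w m ≠ 0 := by
  by_contra hne
  push Not at hne
  apply h
  refine permOrth_of_six ?_ ?_ ?_ ?_ ?_ ?_
  · simpa [T3, Fin.succAbove, pairPerm] using hne 2 3
  · simpa [T3, Fin.succAbove, pairPerm] using hne 1 3
  · simpa [T3, Fin.succAbove, pairPerm] using hne 1 2
  · simpa [T3, Fin.succAbove, pairPerm] using hne 0 3
  · simpa [T3, Fin.succAbove, pairPerm] using hne 0 2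
  · simpa [T3, Fin.succAbove, pairPerm] using hne 0 1

/-- Perm-orthogonality to a fixed vector is closed under subtraction. [folklore] -/
theorem permOrth_sub {u v w : Fin 4 → K} (hu : PermOrth u w) (hv : PermOrth v w) : PermOrth (u - v) w := by
  intro p q hpq
  have h1 := hu p q hpq
  have h2 := hv p q hpq
  simp only [pairPerm, Pi.sub_apply] at h1 h2 ⊢
  linear_combination h1 - h2

/-- **No `2`-plane is perm-orthogonal to a non-zero vector**: if every `b ∈ B` satisfies `b ⊥ c` (`c ≠ 0`) then
`dim B ≤ 1` (`B ⊆ K · (c_p e_p − Σ_{q ≠ p} c_q e_q)` for a coordinate `c_p ≠ 0`). [folklore] -/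
theorem finrank_le_one_of_permOrth (B : Submodule K (Fin 4 → K)) {c : Fin 4 → K} (hc : c ≠ 0)
    (hB : ∀ b ∈ B, PermOrth b c) : finrank K B ≤ 1 := by
  classical
  obtain ⟨p, hp⟩ := Function.ne_iff.1 hc
  have hp : c p ≠ 0 := by simpa using hp
  let v₀ : Fin 4 → K := fun q => if q = p then c p else -c q
  have hv₀ : v₀ ≠ 0 := fun h => hp (by simpa [v₀] using congr_fun h p)
  have hle : B ≤ Submodule.span K {v₀} := by
    intro b hb
    rw [Submodule.mem_span_singleton]
    refine ⟨b p / c p, ?_⟩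
    funext q
    by_cases hq : q = p
    · rw [hq]
      have hv : v₀ p = c p := by simp [v₀]
      simp only [Pi.smul_apply, smul_eq_mul, hv]
      exact div_mul_cancel₀ _ hp
    · have h := hB b hb p q (Ne.symm hq)
      simp only [pairPerm] at h
      simp only [v₀, Pi.smul_apply, smul_eq_mul, if_neg hq]
      rw [div_mul_eq_mul_div, div_eq_iff hp]
      linear_combination -h
  calc finrank K B ≤ finrank K (Submodule.span K ({v₀} : Set (Fin 4 → K))) := Submodule.finrank_mono hle
    _ ≤ 1 := by rw [finrank_span_singleton hv₀]

/-- **Three columns with vanishing maximal minors are dependent**: a `4 × 3` matrix all of whose `3 × 3` minors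
vanish has a non-zero kernel vector (otherwise every `e_l` is in its `3`-dimensional range). [folklore] -/
theorem dep_of_minors (M : Matrix (Fin 4) (Fin 3) K) (h : ∀ I : Fin 3 → Fin 4, (M.submatrix I id).det = 0) :
    ∃ v : Fin 3 → K, v ≠ 0 ∧ M.mulVec v = 0 := by
  classical
  by_contra hne
  push Not at hne
  -- for each `l`, a kernel vector of the submatrix dropping row `l` gives `e_l ∈ range M`
  have hrange : ∀ l : Fin 4, (Pi.single l 1 : Fin 4 → K) ∈ LinearMap.range (Matrix.mulVecLin M) := by
    intro l
    obtain ⟨v, hv, hMv⟩ := Matrix.exists_mulVec_eq_zero_iff.2 (h l.succAbove)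
    have hoff : ∀ t : Fin 3, M.mulVec v (l.succAbove t) = 0 := fun t => by
      have := congr_fun hMv t
      simpa [Matrix.mulVec, Matrix.submatrix_apply, dotProduct] using this
    have hl : M.mulVec v l ≠ 0 := by
      intro h0
      apply hne v hv
      funext l'
      by_cases hl' : l' = l
      · rw [hl']; exact h0
      · obtain ⟨t, rfl⟩ := Fin.exists_succAbove_eq hl'
        exact hoff t
    refine ⟨(M.mulVec v l)⁻¹ • v, ?_⟩
    rw [map_smul, Matrix.mulVecLin_apply]
    funext l'
    simp only [Pi.smul_apply, smul_eq_mul, Pi.single_apply]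
    by_cases hl' : l' = l
    · rw [hl', if_pos rfl, inv_mul_cancel₀ hl]
    · obtain ⟨t, rfl⟩ := Fin.exists_succAbove_eq hl'
      rw [hoff t, mul_zero, if_neg hl']
  have htop : (⊤ : Submodule K (Fin 4 → K)) ≤ LinearMap.range (Matrix.mulVecLin M) := by
    intro x _
    have hx : x = ∑ l, x l • (Pi.single l 1 : Fin 4 → K) := by
      funext m
      simp [Finset.sum_apply, Pi.single_apply]
    rw [hx]
    exact Submodule.sum_mem _ fun l _ => Submodule.smul_mem _ _ (hrange l)
  have h1 := Submodule.finrank_mono htop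
  have h2 := LinearMap.finrank_range_le (Matrix.mulVecLin M)
  rw [finrank_top, finrank_fintype_fun_eq_card, Fintype.card_fin] at h1
  rw [finrank_fintype_fun_eq_card, Fintype.card_fin] at h2
  omega

/-- The complementary pair of a pair of indices, with a cover of `Fin 4`. [folklore] -/
theorem exists_compl_pair_cover : ∀ p q : Fin 4, p ≠ q → ∃ p' q' : Fin 4, p' ≠ q' ∧ p' ≠ p ∧ p' ≠ q ∧
    q' ≠ p ∧ q' ≠ q ∧ ∀ i : Fin 4, i = p ∨ i = q ∨ i = p' ∨ i = q' := by
  decide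

/-- `T3 (u, e_m, w)_l = u_{p'} w_{q'} + u_{q'} w_{p'}` for `{l, m, p', q'} = {0, 1, 2, 3}`. [folklore] -/
theorem T3_single_mid (u w : Fin 4 → K) : ∀ l m p' q' : Fin 4, l ≠ m → p' ≠ l → p' ≠ m → q' ≠ l → q' ≠ m →
    p' ≠ q' → T3 u (Pi.single m 1) w l = u p' * w q' + u q' * w p' := by
  intro l m p' q'
  fin_cases l <;> fin_cases m <;> intro hlm <;> (first | exact absurd rfl hlm | skip) <;>
    fin_cases p' <;> intro h1 h2 <;> (first | exact absurd rfl h1 | exact absurd rfl h2 | skip) <;>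
    fin_cases q' <;> intro h3 h4 h5 <;>
    (first | exact absurd rfl h3 | exact absurd rfl h4 | exact absurd rfl h5 | skip) <;>
    simp [T3, Fin.succAbove] <;> ring

/-! ## 2. Case (i): a rank-two pairing `P(b₁,c₀)` propagates `A^⊥` -/

/-- **Case (i).**  If `T3 (A, B, c₀) = 0`, the three pairing matrices at every `(a; b; c₀)` have a common column
space of dimension `≤ 2` (all `3 × 3` minors of `N = [P(b,c₀) | P(a,c₀) | P(a,b)]` vanish), and `b₁ ∈ B` is NOT
perm-orthogonal to `c₀`, then `T3 (A, A, c₀) = 0` and `T3 (A, A, b₁) = 0`: two columns of `P(b₁,c₀)` are independent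
and orthogonal to `A`, so every column of `P(a,c₀)` and `P(a,b₁)` is orthogonal to `A` as well. [folklore] -/
theorem caseI (A B : Submodule K (Fin 4 → K)) (c₀ : Fin 4 → K)
    (hT : ∀ a ∈ A, ∀ b ∈ B, ∀ l, T3 a b c₀ l = 0)
    (hD : ∀ a ∈ A, ∀ b ∈ B, ∀ (I : Fin 3 → Fin 4) (J : Fin 3 → Fin 3 × Fin 4),
      ((Matrix.of fun (l : Fin 4) (p : Fin 3 × Fin 4) =>
        ![T3 (Pi.single p.2 1) b c₀ l, T3 a (Pi.single p.2 1) c₀ l, T3 a b (Pi.single p.2 1) l] p.1).submatrix I J).det = 0)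
    {b₁ : Fin 4 → K} (hb₁ : b₁ ∈ B) (hnp : ¬ PermOrth b₁ c₀) :
    (∀ a ∈ A, ∀ a' ∈ A, ∀ m, T3 a' a c₀ m = 0) ∧ (∀ a ∈ A, ∀ a' ∈ A, ∀ m, T3 a' a b₁ m = 0) := by
  classical
  obtain ⟨l₁, l₂, hne⟩ := exists_T3_single_ne_zero hnp
  -- every column of the blocks `1, 2` of `N(a, b₁, c₀)` is orthogonal to `A`
  have key : ∀ a ∈ A, ∀ p₃ : Fin 3 × Fin 4, ∀ a' ∈ A,
      ∑ l, (Matrix.of fun (l : Fin 4) (p : Fin 3 × Fin 4) =>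
        ![T3 (Pi.single p.2 1) b₁ c₀ l, T3 a (Pi.single p.2 1) c₀ l, T3 a b₁ (Pi.single p.2 1) l] p.1) l p₃ * a' l = 0 := by
    intro a ha p₃ a' ha'
    set N : Matrix (Fin 4) (Fin 3 × Fin 4) K := (Matrix.of fun (l : Fin 4) (p : Fin 3 × Fin 4) =>
        ![T3 (Pi.single p.2 1) b₁ c₀ l, T3 a (Pi.single p.2 1) c₀ l, T3 a b₁ (Pi.single p.2 1) l] p.1) with hN
    have hN0 : ∀ l m, N l ((0 : Fin 3), m) = T3 (Pi.single m 1) b₁ c₀ l := fun l m => by simp [hN]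
    let J : Fin 3 → Fin 3 × Fin 4 := ![((0 : Fin 3), l₁), ((0 : Fin 3), l₂), p₃]
    have hJ0 : J 0 = ((0 : Fin 3), l₁) := rfl
    have hJ1 : J 1 = ((0 : Fin 3), l₂) := rfl
    have hJ2 : J 2 = p₃ := rfl
    obtain ⟨v, hv, hMv⟩ := dep_of_minors (N.submatrix id J) (fun I => by
      rw [Matrix.submatrix_submatrix]
      exact hD a ha b₁ hb₁ I J)
    have hsum : ∀ l, v 0 * T3 (Pi.single l₁ 1) b₁ c₀ l + v 1 * T3 (Pi.single l₂ 1) b₁ c₀ l +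
        v 2 * N l p₃ = 0 := by
      intro l
      have h := congr_fun hMv l
      rw [Matrix.mulVec, dotProduct, Fin.sum_univ_three] at h
      simp only [Matrix.submatrix_apply, id, hJ0, hJ1, hJ2, hN0, Pi.zero_apply] at h
      linear_combination h
    have hv2 : v 2 ≠ 0 := by
      intro hv2
      apply hv
      have h1 := hsum l₁
      have h2 := hsum l₂
      rw [hv2, zero_mul, add_zero, T3_single_self, mul_zero, zero_add, T3_single_symm] at h1
      have hv1 : v 1 = 0 := (mul_eq_zero.1 h1).resolve_right hne
      rw [hv2, hv1, zero_mul, zero_mul, add_zero, add_zero] at h2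
      have hv0 : v 0 = 0 := (mul_eq_zero.1 h2).resolve_right hne
      funext t
      fin_cases t
      · exact hv0
      · exact hv1
      · exact hv2
    -- pair the relation with `a'`
    have hpair : v 2 * ∑ l, N l p₃ * a' l = 0 := by
      have h0 : ∑ l, (v 0 * T3 (Pi.single l₁ 1) b₁ c₀ l + v 1 * T3 (Pi.single l₂ 1) b₁ c₀ l +
          v 2 * N l p₃) * a' l = 0 := Finset.sum_eq_zero fun l _ => by rw [hsum l, zero_mul]
      have e1 : ∑ l, T3 (Pi.single l₁ 1) b₁ c₀ l * a' l = 0 := by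
        rw [T3_dot_swap, sum_T3_single]; exact hT a' ha' b₁ hb₁ l₁
      have e2 : ∑ l, T3 (Pi.single l₂ 1) b₁ c₀ l * a' l = 0 := by
        rw [T3_dot_swap, sum_T3_single]; exact hT a' ha' b₁ hb₁ l₂
      have hsplit : ∑ l, (v 0 * T3 (Pi.single l₁ 1) b₁ c₀ l + v 1 * T3 (Pi.single l₂ 1) b₁ c₀ l +
          v 2 * N l p₃) * a' l = v 0 * ∑ l, T3 (Pi.single l₁ 1) b₁ c₀ l * a' l +
          v 1 * ∑ l, T3 (Pi.single l₂ 1) b₁ c₀ l * a' l + v 2 * ∑ l, N l p₃ * a' l := by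
        rw [Finset.mul_sum, Finset.mul_sum, Finset.mul_sum, ← Finset.sum_add_distrib, ← Finset.sum_add_distrib]
        exact Finset.sum_congr rfl fun l _ => by ring
      rw [hsplit, e1, e2, mul_zero, mul_zero, zero_add, zero_add] at h0
      exact h0
    exact (mul_eq_zero.1 hpair).resolve_left hv2
  refine ⟨fun a ha a' ha' m => ?_, fun a ha a' ha' m => ?_⟩
  · have h := key a ha ((1 : Fin 3), m) a' ha'
    simp only [Matrix.of_apply, Matrix.cons_val_one, Matrix.cons_val_zero] at h
    have h' : ∑ l, T3 (Pi.single m 1) a c₀ l * a' l = 0 := by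
      rw [← h]; exact Finset.sum_congr rfl fun l _ => by rw [T3_swap₁₂]
    rwa [T3_dot_swap, sum_T3_single] at h'
  · have h := key a ha ((2 : Fin 3), m) a' ha'
    simp only [Matrix.of_apply, Matrix.cons_val_two, Matrix.tail_cons, Matrix.head_cons] at h
    have h' : ∑ l, T3 (Pi.single m 1) b₁ a l * a' l = 0 := by
      rw [← h]; exact Finset.sum_congr rfl fun l _ => by rw [T3_swap₁₃]
    rw [T3_dot_swap, sum_T3_single] at h'
    rwa [T3_swap₂₃] at h'

end Summit.ValiantsHypothesis.ValiantsHypothesis.Theorems.SymPencilPerFourOneRowToric
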